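import Summits.QuantumFields.BalabanUV.Beta.D1BFx.TwoBondWardPairingRoad
import Summits.QuantumFields.BalabanUV.Beta.D1BFx.GhostAveragingSquare

/-!
# `BalabanUV.Beta.D1BFx.GhostWardTransversal` — road «BF-x» for binder row D1, slot (K), junction (J3), brick (B2) SECOND HALF (instance):
# **THE COMPLETED GHOST FINE HESSIAN IS WARD-DIVERGENCE-FREE IN BOTH BONDS, AND ITS PAIRING WITH THE ROAD's CO-DRESSED WEIGHTS `colH G₀`
# EQUALS ITS PAIRING WITH THE UNDRESSED WEIGHTS `colH K₀`** — the axial block-mean dressing is INVISIBLE on the full ghost word, at the level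
# of the fine-table pairing (row owner an2 g40's R-D1-g40-1 (W-iii)–(W-iv) ∕ road owner d1-p2 g19's A-1 ∕ ρ-g19-4 ∕ g20's W-1, made a kernel theorem;
# stated FIRST for any localised triple `(A, S, W)` with fine Ward rows — W-1's preferred form — then at the ghost data, at any root and at the road's root)

OBJECTS (all in the tree): the ghost leg `Ggh n a` (`GhostLeg`); the COMPLETED first-order stencil `SghAt ρ n (c·n²) (c·a)` (`GhostStencilRooted`:
`cK•ghCur + cQ•qAntiAt`) and two-bond table `WghAt ρ n (−c) (c·n²) (c·a)` (leaf-02 g2's `GhostAveragingSquare`: the kinetic contact `ghX` ⊕ the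
averaging square `qSqAt` — the `Q′(U)*Q′(U)` second jets); their fine Hessian `fineHessA (Ggh n a) S W κ l u u′ = ½·tadpole − ½·bubble`
(`ReducedKernelSandwichLeg`); the road's ℋ-column weights `colH K₀ n μ y`, `K₀ = KInvStep n 0`, and their block-mean axial co-dressing
`colH G₀ n μ y`, `G₀ = coDressKBmAt (toSite r) n K₀` (in-block root `r`).
* §1 **`divFree₁_ghostHess` ∕ `divFree₂_ghostHess`**: `Σ_κ (H κ l u u′ − H κ l (u−e_κ) u′) = 0` and `Σ_l (H κ l u u′ − H κ l u (u′−e_l)) = 0` for the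
  completed ghost fine Hessian `H` — leaf-01 g2's `FineHessianWard.divFree_fineHessA_of_wardLaws` at leaf-01 g3's (W1) `ward₁_Ggh_rooted` and
  leaf-02 g2's (W2) `ward₂_WghAt`, second bond by `fineHessA_transpose` ∕ `WghAt_symm`.
* §2 **`exists_decay_fineHessA`** — GENERIC: for a spread leg `A`, stencils `BiLoc` at `(u,u)` and a table `BiLoc` at `(u,u′)` (one rate),
  `|fineHessA A S W κ l u u′| ≤ C·e^{−δ′|u−u′|₁}` (`DressedTablesLeg.exists_decay_{tadpole,bubble}TableA`); the ghost instance `exists_decay_ghostHess`.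
* §3 `toSite_inBlock`; **`fineHessA_pairing_dressed_eq_undressed`** — GENERIC (road owner d1-p2 g20 W-1's preferred form): for ANY localised triple
  `(A, S, W)` whose fine Hessian has divergence-free rows in each bond (`hdiv₁ hdiv₂`),
  `Σ_κ Σ'_u colH G₀ (m+1) μ y κ u · Σ_l Σ'_{u′} colH G₀ (m+1) ν y′ l u′ · H κ l u u′ = (the same with K₀)` — `TwoBondWardPairingRoad.road_pairing_dressed_eq_undressed`
  (the road's weights: «G0-COL-ENV», `colH_coDressKBmAt_eq_sub_grad`, `abs_bmGaugeAt_le`, `TwoBondWardPairing.pairing_grad_shift_invariant`) at §2;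
  then the GHOST INSTANCE **`ghost_pairing_dressed_eq_undressed (m) (hr) (ha) (hρ) (c)`** (any stencil root `ρ`, any dressing root `r`, any real `c`)
  and the road's own root **`ghost_pairing_dressed_eq_undressed_road`** (`ρ = toSite r`, W-1).
NOT HERE (honest): the re-expression as `hessKer` ∕ `TOfGh` WORDS (sequel `GhostWardWord` over `PackedWordPairing` ∕ `TwoBondWardPairingJoint`);
CHECK-N0 (colour weight ∕ sign `cgh`); any estimate.

HONEST DEPENDENCY (cell records, verbatim): «continuum YM on T⁴ ⇐ BetaPertH ∧ nine spine estimates (0/9 proved); BetaPertH ⇐ (D1) ∧ (D4) ∧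
CAP+tail; G-an2-4 gates asym, D1 and NE2/3/4.»  HONEST FRAMING (cell contract, verbatim): «discharging `BetaPertH` makes Bałaban's UV stability
UNCONDITIONAL — a real constructive-QFT result; it is NOT the continuum limit and NOT the Clay problem.»  THIS MODULE DISCHARGES NOTHING of the
wall: [folklore] composition BY NAME + `tsum` bookkeeping over OUR objects; (J3) remains DISPLAYED until PART 11′ consumes this; no definition,
no `def … : Prop`, no notation, nothing cited, 0 sorry.  0 root-level binders of row D1 discharged (hW ∕ hR-sockets ∕ hSX-socket ∕ D1Tel ∕ D1Rep — 0);
(K) NOT closed; NOT D1, NOT `BetaPertH`, NOT continuum, NOT Clay.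

ABSOLUTE RULE (cell charter, verbatim): «No internally-minted statement may enter as a cited fact. Every hypothesis is either kernel-proved in
this package or a verbatim quotation of a PUBLISHED theorem with page reference. The manuscript(s) under audit are NOT citable for their own
disputed steps — they are the thing under adjudication; programme-internal (2001/route/tribunal) claims are never citable.»

Unit `b2b-balaban-beta-d1-formalise-leaf-04` (gen 21), D1 formalisation swarm leaf prover 04, road «BF-x»; (B2) second half per R-D1-g40-1 ∕ ρ-g19-4 (journal).
-/

noncomputable section

open Finset
open scoped BigOperators
open Literature.MathematicalPhysics.QuantumFieldTheory
open Literature.MathematicalPhysics.QuantumFieldTheory.Balaban1983to89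
open Literature.MathematicalPhysics.QuantumFieldTheory.Balaban1983to89.Beta
open B12Sec2to5 (l1 l1_nonneg Decay510)
open B5Hk163Strip (kappa163 kappa163_pos)
open B5Hk163Decay (MG163)
open B4TorusKernel (periodConst)
open ExpKernelCalculus (Site MKer BiLoc Zl Zl_pos summable_exp_shift summable_exp_shift' tsum_exp_shift tsum_exp_shift' l1_sub_triangle
  l1_sub_symm)
open AffineAveraging (Form0 Form1 box toSite unitVec)
open OneStepKernelFamily (KInvStep colH)
open KernelWard (divV divW)
open Summit.QuantumFields.BalabanUV.Beta.AxialProjectorBlockMean (bmGaugeAt)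
open Summit.QuantumFields.BalabanUV.Beta.AxialDressingRooted (coDressKBmAt)
open Summit.QuantumFields.BalabanUV.Beta.GAN24.CoDressedColumnPairing (colH_coDressKBmAt_eq_sub_grad abs_bmGaugeAt_le)
open Summit.QuantumFields.BalabanUV.Beta.D1BFx.MomentTransferPeriodic (baseKer)
open Summit.QuantumFields.BalabanUV.Beta.D1BFx.GhostLeg (Ggh spr_Ggh)
open Summit.QuantumFields.BalabanUV.Beta.D1BFx.GhostStencilRooted (SghAt biLoc_SghAt)
open Summit.QuantumFields.BalabanUV.Beta.D1BFx.GhostStencilWard (genX unitVec_eq)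
open Summit.QuantumFields.BalabanUV.Beta.D1BFx.GhostStencil (l1_zero)
open B5Kernel166Decay (periodConst_pos)
open B4ContourShift (supNorm supNorm_nonneg)
open Literature.MathematicalPhysics.QuantumFieldTheory.LatticeForm (quo)
open Summit.QuantumFields.BalabanUV.Beta.D1BFx.GhostLegWard (biLoc_smul_genX)
open Summit.QuantumFields.BalabanUV.Beta.D1BFx.GhostLegWardRooted (ward₁_Ggh_rooted)
open Summit.QuantumFields.BalabanUV.Beta.D1BFx.GhostAveragingSquare (WghAt biLoc_WghAt WghAt_symm ward₂_WghAt)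
open Summit.QuantumFields.BalabanUV.Beta.D1BFx.ReducedKernelSandwichLeg (fineHessA fineHessA_apply fineHessA_transpose)
open Summit.QuantumFields.BalabanUV.Beta.D1BFx.DressedTablesLeg (exists_decay_bubbleTableA exists_decay_tadpoleTableA)
open Summit.QuantumFields.BalabanUV.Beta.D1BFx.FineHessianWard (divFree_fineHessA_of_wardLaws)
open Summit.QuantumFields.BalabanUV.Beta.TameKernelCalculus (Spr)
open Summit.QuantumFields.BalabanUV.Beta.D1BFx.TwoBondWardPairingRoad (road_pairing_dressed_eq_undressed summable_row_of_decay)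

namespace Summit.QuantumFields.BalabanUV.Beta.D1BFx.GhostWardTransversal

section Generic

variable (n : ℕ) [NeZero n] {a : ℝ} (ha : 0 < a) {ρ : Site 4} (hρ : ∀ i : Fin 4, 0 ≤ ρ i ∧ ρ i < n) (c : ℝ)

/-! ## §1 The completed ghost fine Hessian is Ward-divergence-free in both bonds -/

section DivFree
include ha hρ

/-- [folklore] **FIRST BOND**: `Σ_κ (H κ l u u′ − H κ l (u − e_κ) u′) = 0` for the fine Hessian `H` of the completed ghost data
`(Ggh n a, SghAt ρ n (c·n²) (c·a), WghAt ρ n (−c) (c·n²) (c·a))` — `divFree_fineHessA_of_wardLaws` at (W1) `ward₁_Ggh_rooted`, (W2) `ward₂_WghAt`. -/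
theorem divFree₁_ghostHess (l : Fin 4) (u' u : Site 4) :
    ∑ κ : Fin 4, (fineHessA (Ggh n a) (SghAt ρ n (c * (n : ℝ) ^ 2) (c * a)) (WghAt ρ n (-c) (c * (n : ℝ) ^ 2) (c * a)) κ l u u'
      - fineHessA (Ggh n a) (SghAt ρ n (c * (n : ℝ) ^ 2) (c * a)) (WghAt ρ n (-c) (c * (n : ℝ) ^ 2) (c * a)) κ l (u - unitVec κ) u') = 0 := by
  have hn : (0 : ℝ) < 1 / (n : ℝ) := div_pos one_pos (by exact_mod_cast Nat.pos_of_ne_zero (NeZero.ne n))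
  have h := divFree_fineHessA_of_wardLaws (A := Ggh n a) (S := SghAt ρ n (c * (n : ℝ) ^ 2) (c * a))
    (Wf := WghAt ρ n (-c) (c * (n : ℝ) ^ 2) (c * a)) (fun y => (-c) • genX y) (spr_Ggh n a ha)
    (fun μ y => biLoc_SghAt n μ y hρ (c * (n : ℝ) ^ 2) (c * a) zero_le_one)
    (fun μ y l y' => biLoc_WghAt n hρ (-c) (c * (n : ℝ) ^ 2) (c * a) zero_le_one μ y l y')
    (fun y => biLoc_smul_genX c y (1 / n)) hn
    (fun y => ward₁_Ggh_rooted n hρ ha c y)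
    (fun y l y' => ward₂_WghAt n hρ (-c) (c * (n : ℝ) ^ 2) (c * a) y l y') l u' u
  -- `h` is stated with `B6BondElimination.unitVec`; same vectors
  simp only [unitVec_eq] at h
  rw [← neg_eq_zero, ← h, ← Finset.sum_neg_distrib]
  exact Finset.sum_congr rfl fun κ _ => by ring

/-- [folklore] **SECOND BOND**: `Σ_l (H κ l u u′ − H κ l u (u′ − e_l)) = 0` (the table is bond-swap symmetric: `fineHessA_transpose` ∕ `WghAt_symm`, then §1 first bond). -/
theorem divFree₂_ghostHess (κ : Fin 4) (u u' : Site 4) :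
    ∑ l : Fin 4, (fineHessA (Ggh n a) (SghAt ρ n (c * (n : ℝ) ^ 2) (c * a)) (WghAt ρ n (-c) (c * (n : ℝ) ^ 2) (c * a)) κ l u u'
      - fineHessA (Ggh n a) (SghAt ρ n (c * (n : ℝ) ^ 2) (c * a)) (WghAt ρ n (-c) (c * (n : ℝ) ^ 2) (c * a)) κ l u (u' - unitVec l)) = 0 := by
  have hn : (0 : ℝ) < 1 / (n : ℝ) := div_pos one_pos (by exact_mod_cast Nat.pos_of_ne_zero (NeZero.ne n))
  have hT : ∀ (κ' l' : Fin 4) (v v' : Site 4),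
      fineHessA (Ggh n a) (SghAt ρ n (c * (n : ℝ) ^ 2) (c * a)) (WghAt ρ n (-c) (c * (n : ℝ) ^ 2) (c * a)) κ' l' v v'
        = fineHessA (Ggh n a) (SghAt ρ n (c * (n : ℝ) ^ 2) (c * a)) (WghAt ρ n (-c) (c * (n : ℝ) ^ 2) (c * a)) l' κ' v' v :=
    fun κ' l' v v' => fineHessA_transpose (Ggh n a) (spr_Ggh n a ha)
      (fun μ y => biLoc_SghAt n μ y hρ (c * (n : ℝ) ^ 2) (c * a) zero_le_one) hn
      (fun μ y l y' => WghAt_symm ρ n (-c) (c * (n : ℝ) ^ 2) (c * a) μ y l y') κ' l' v v'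
  simp_rw [hT κ]
  exact divFree₁_ghostHess n ha hρ c κ u u'

end DivFree

end Generic

/-! ## §2 Off-diagonal decay of the fine Hessian of a localised triple (generic leg ∕ stencils ∕ table), and the ghost instance -/

section DecayGeneric

variable {F : Type*} [Fintype F] [Nonempty F] {A : MKer 4 F} {S : Fin 4 → Site 4 → MKer 4 F}
  {W : Fin 4 → Site 4 → Fin 4 → Site 4 → MKer 4 F} {Cs C2 δ : ℝ}

/-- [folklore] **OFF-DIAGONAL DECAY OF THE FINE HESSIAN** of a spread leg `A`, stencils `S` localised at `(u, u)` and a table `W` localised at `(u, u′)`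
(one rate `δ > 0`): `∃ C δ′ > 0, |fineHessA A S W κ l u u′| ≤ C·e^{−δ′|u − u′|₁}` (`DressedTablesLeg.exists_decay_tadpoleTableA ∕ _bubbleTableA`). -/
theorem exists_decay_fineHessA (hA : Spr A) (hS : ∀ κ u, BiLoc (S κ u) u u Cs δ) (hW : ∀ κ u l u', BiLoc (W κ u l u') u u' C2 δ)
    (hδ : 0 < δ) : ∃ C δ' : ℝ, 0 < δ' ∧ ∀ (κ l : Fin 4) (u u' : Site 4),
      |fineHessA A S W κ l u u'| ≤ C * Real.exp (-δ' * l1 (u - u')) := by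
  obtain ⟨C₁, δ₁, hδ₁, h₁⟩ := exists_decay_tadpoleTableA (A := A) (Wf := W) hA hW hδ
  obtain ⟨C₂, δ₂, hδ₂, h₂⟩ := exists_decay_bubbleTableA (A := A) (S := S) hA hS hδ
  have hC₁ : 0 ≤ C₁ := by
    have h0 : (0 : ℝ) ≤ C₁ * Real.exp (-δ₁ * l1 (0 : Site 4)) := (abs_nonneg _).trans (h₁ 0 0 0 0)
    rw [l1_zero, mul_zero, Real.exp_zero, mul_one] at h0
    exact h0
  have hC₂ : 0 ≤ C₂ := by
    have h0 : (0 : ℝ) ≤ C₂ * Real.exp (-δ₂ * l1 (0 : Site 4)) := (abs_nonneg _).trans (h₂ 0 0 0 0)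
    rw [l1_zero, mul_zero, Real.exp_zero, mul_one] at h0
    exact h0
  refine ⟨C₁ + C₂, min δ₁ δ₂, lt_min hδ₁ hδ₂, fun κ l u u' => ?_⟩
  have e : u = u' + (u - u') := by abel
  have k₁ := h₁ κ l u' (u - u')
  have k₂ := h₂ κ l u' (u - u')
  rw [baseKer, ← e] at k₁ k₂
  have hl : 0 ≤ l1 (u - u') := l1_nonneg _
  have m₁ : Real.exp (-δ₁ * l1 (u - u')) ≤ Real.exp (-min δ₁ δ₂ * l1 (u - u')) :=
    Real.exp_le_exp.mpr (by nlinarith [min_le_left δ₁ δ₂])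
  have m₂ : Real.exp (-δ₂ * l1 (u - u')) ≤ Real.exp (-min δ₁ δ₂ * l1 (u - u')) :=
    Real.exp_le_exp.mpr (by nlinarith [min_le_right δ₁ δ₂])
  rw [fineHessA_apply]
  calc |_ + _| ≤ |_| + |_| := abs_add_le _ _
    _ ≤ C₁ * Real.exp (-δ₁ * l1 (u - u')) + C₂ * Real.exp (-δ₂ * l1 (u - u')) := add_le_add k₁ k₂
    _ ≤ C₁ * Real.exp (-min δ₁ δ₂ * l1 (u - u')) + C₂ * Real.exp (-min δ₁ δ₂ * l1 (u - u')) :=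
        add_le_add (mul_le_mul_of_nonneg_left m₁ hC₁) (mul_le_mul_of_nonneg_left m₂ hC₂)
    _ = (C₁ + C₂) * Real.exp (-min δ₁ δ₂ * l1 (u - u')) := by ring

end DecayGeneric

section Decay

variable (n : ℕ) [NeZero n] {a : ℝ} (ha : 0 < a) {ρ : Site 4} (hρ : ∀ i : Fin 4, 0 ≤ ρ i ∧ ρ i < n) (c : ℝ)
include ha hρ

/-- [folklore] **THE GHOST INSTANCE**: `∃ C δ > 0, |H κ l u u′| ≤ C·e^{−δ|u − u′|₁}` for the completed ghost fine Hessian (§2 at `spr_Ggh`,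
`biLoc_SghAt`, `biLoc_WghAt`, rate `1/n`). -/
theorem exists_decay_ghostHess : ∃ C δ : ℝ, 0 < δ ∧ ∀ (κ l : Fin 4) (u u' : Site 4),
    |fineHessA (Ggh n a) (SghAt ρ n (c * (n : ℝ) ^ 2) (c * a)) (WghAt ρ n (-c) (c * (n : ℝ) ^ 2) (c * a)) κ l u u'|
      ≤ C * Real.exp (-δ * l1 (u - u')) :=
  have hn : (0 : ℝ) < 1 / (n : ℝ) := div_pos one_pos (by exact_mod_cast Nat.pos_of_ne_zero (NeZero.ne n))
  exists_decay_fineHessA (spr_Ggh n a ha) (fun μ y => biLoc_SghAt n μ y hρ (c * (n : ℝ) ^ 2) (c * a) zero_le_one)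
    (fun μ y l y' => biLoc_WghAt n hρ (-c) (c * (n : ℝ) ^ 2) (c * a) zero_le_one μ y l y') hn

end Decay

/-! ## §3 The dressed pairing equals the undressed one: generic localised triple with fine Ward rows, then the ghost instance -/

/-- [folklore] The road's block root is in the block: `0 ≤ toSite r i < N` for `r ∈ box 4 N`. -/
theorem toSite_inBlock {N : ℕ} {r : Fin (3 + 1) → ℕ} (hr : r ∈ box (3 + 1) N) (i : Fin 4) : 0 ≤ toSite r i ∧ toSite r i < N := by
  have h := Finset.mem_range.1 (Fintype.mem_piFinset.1 hr i)
  exact ⟨by simp only [toSite]; exact_mod_cast Nat.zero_le _, by simp only [toSite]; exact_mod_cast h⟩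

section MainGeneric

variable (m : ℕ) {r : Fin (3 + 1) → ℕ} (hr : r ∈ box (3 + 1) (m + 1))
  {F : Type*} [Fintype F] [Nonempty F] {A : MKer 4 F} {S : Fin 4 → Site 4 → MKer 4 F}
  {W : Fin 4 → Site 4 → Fin 4 → Site 4 → MKer 4 F} {Cs C2 δ : ℝ}
include hr

/-- [folklore] **«TRANSVERSALITY» FOR ANY LOCALISED TRIPLE WITH FINE WARD ROWS** (road owner d1-p2 g20 W-1's preferred form): for a spread leg `A`,
localised stencils `S` and table `W` (one rate `δ > 0`) whose fine Hessian `H := fineHessA A S W` has divergence-free rows in each bond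
(`hdiv₁`, `hdiv₂` — e.g. `FineHessianWard.divFree_fineHessA_of_wardLaws` at two Ward laws), the two-slot pairing of `H` with the road's
co-dressed columns `colH G₀ (m+1)` equals the pairing with the undressed columns `colH K₀ (m+1)` (F3a `road_pairing_dressed_eq_undressed` at §2). -/
theorem fineHessA_pairing_dressed_eq_undressed (hA : Spr A) (hS : ∀ κ u, BiLoc (S κ u) u u Cs δ)
    (hW : ∀ κ u l u', BiLoc (W κ u l u') u u' C2 δ) (hδ : 0 < δ)
    (hdiv₁ : ∀ (l : Fin 4) (u' u : Site 4), ∑ κ : Fin 4, (fineHessA A S W κ l u u' - fineHessA A S W κ l (u - unitVec κ) u') = 0)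
    (hdiv₂ : ∀ (κ : Fin 4) (u u' : Site 4), ∑ l : Fin 4, (fineHessA A S W κ l u u' - fineHessA A S W κ l u (u' - unitVec l)) = 0)
    (μ : Fin 4) (y : Site 4) (ν : Fin 4) (y' : Site 4) :
    ∑ κ : Fin 4, ∑' u : Site 4, colH (coDressKBmAt (toSite r) (m + 1) (KInvStep (d := 3) (m + 1) 0)) (m + 1) μ y κ u
        * ∑ l : Fin 4, ∑' u' : Site 4, colH (coDressKBmAt (toSite r) (m + 1) (KInvStep (d := 3) (m + 1) 0)) (m + 1) ν y' l u'
            * fineHessA A S W κ l u u'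
      = ∑ κ : Fin 4, ∑' u : Site 4, colH (KInvStep (d := 3) (m + 1) 0) (m + 1) μ y κ u
          * ∑ l : Fin 4, ∑' u' : Site 4, colH (KInvStep (d := 3) (m + 1) 0) (m + 1) ν y' l u'
              * fineHessA A S W κ l u u' := by
  obtain ⟨C, δ', hδ', hH⟩ := exists_decay_fineHessA hA hS hW hδ
  exact road_pairing_dressed_eq_undressed m hr hδ' hH hdiv₁ hdiv₂ μ y ν y'

end MainGeneric

section Main

variable (m : ℕ) {r : Fin (3 + 1) → ℕ} (hr : r ∈ box (3 + 1) (m + 1)) {a : ℝ} (ha : 0 < a) {ρ : Site 4}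
  (hρ : ∀ i : Fin 4, 0 ≤ ρ i ∧ ρ i < (m + 1 : ℕ)) (c : ℝ)
include hr ha hρ

/-- [folklore] **«GHOST WARD AT U = 1 — TRANSVERSALITY» AT THE LEVEL OF THE FINE-TABLE PAIRING**: for the completed ghost data
`(Ggh, SghAt ρ (m+1) (c(m+1)²) (ca), WghAt ρ (m+1) (−c) (c(m+1)²) (ca))` (any in-block stencil root `ρ`, any real `c`) and the road's two weight
families — the undressed ℋ-columns `colH K₀ (m+1)` and their block-mean axial co-dressing `colH G₀ (m+1)`, `G₀ = coDressKBmAt (toSite r) (m+1) K₀`,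
`K₀ = KInvStep (m+1) 0`, any in-block dressing root `r` — the two-slot pairing with the fine Hessian is THE SAME at `G₀` and at `K₀`:
`Σ_κ Σ'_u colH G₀ μ y κ u · Σ_l Σ'_{u′} colH G₀ ν y′ l u′ · H κ l u u′ = Σ_κ Σ'_u colH K₀ μ y κ u · Σ_l Σ'_{u′} colH K₀ ν y′ l u′ · H κ l u u′`
— the axial dressing is INVISIBLE on the full ghost word (the generic theorem at §1's two Ward rows). -/
theorem ghost_pairing_dressed_eq_undressed (μ : Fin 4) (y : Site 4) (ν : Fin 4) (y' : Site 4) :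
    ∑ κ : Fin 4, ∑' u : Site 4, colH (coDressKBmAt (toSite r) (m + 1) (KInvStep (d := 3) (m + 1) 0)) (m + 1) μ y κ u
        * ∑ l : Fin 4, ∑' u' : Site 4, colH (coDressKBmAt (toSite r) (m + 1) (KInvStep (d := 3) (m + 1) 0)) (m + 1) ν y' l u'
            * fineHessA (Ggh (m + 1) a) (SghAt ρ (m + 1) (c * ((m + 1 : ℕ) : ℝ) ^ 2) (c * a))
                (WghAt ρ (m + 1) (-c) (c * ((m + 1 : ℕ) : ℝ) ^ 2) (c * a)) κ l u u'
      = ∑ κ : Fin 4, ∑' u : Site 4, colH (KInvStep (d := 3) (m + 1) 0) (m + 1) μ y κ u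
          * ∑ l : Fin 4, ∑' u' : Site 4, colH (KInvStep (d := 3) (m + 1) 0) (m + 1) ν y' l u'
              * fineHessA (Ggh (m + 1) a) (SghAt ρ (m + 1) (c * ((m + 1 : ℕ) : ℝ) ^ 2) (c * a))
                  (WghAt ρ (m + 1) (-c) (c * ((m + 1 : ℕ) : ℝ) ^ 2) (c * a)) κ l u u' :=
  have hn : (0 : ℝ) < 1 / ((m + 1 : ℕ) : ℝ) := div_pos one_pos (by exact_mod_cast Nat.succ_pos m)
  fineHessA_pairing_dressed_eq_undressed m hr (spr_Ggh (m + 1) a ha)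
    (fun κ u => biLoc_SghAt (m + 1) κ u hρ (c * ((m + 1 : ℕ) : ℝ) ^ 2) (c * a) zero_le_one)
    (fun κ u l u' => biLoc_WghAt (m + 1) hρ (-c) (c * ((m + 1 : ℕ) : ℝ) ^ 2) (c * a) zero_le_one κ u l u') hn
    (fun l u' u => divFree₁_ghostHess (m + 1) ha hρ c l u' u) (fun κ u u' => divFree₂_ghostHess (m + 1) ha hρ c κ u u') μ y ν y'

end Main

section Road

variable (m : ℕ) {r : Fin (3 + 1) → ℕ} (hr : r ∈ box (3 + 1) (m + 1)) {a : ℝ} (ha : 0 < a) (c : ℝ)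
include hr ha

/-- [folklore] **THE ROAD's OWN ROOT** (owner W-1: the stencils' root IS the dressing root `ρ := toSite r`): the same identity at `ρ = toSite r`. -/
theorem ghost_pairing_dressed_eq_undressed_road (μ : Fin 4) (y : Site 4) (ν : Fin 4) (y' : Site 4) :
    ∑ κ : Fin 4, ∑' u : Site 4, colH (coDressKBmAt (toSite r) (m + 1) (KInvStep (d := 3) (m + 1) 0)) (m + 1) μ y κ u
        * ∑ l : Fin 4, ∑' u' : Site 4, colH (coDressKBmAt (toSite r) (m + 1) (KInvStep (d := 3) (m + 1) 0)) (m + 1) ν y' l u'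
            * fineHessA (Ggh (m + 1) a) (SghAt (toSite r) (m + 1) (c * ((m + 1 : ℕ) : ℝ) ^ 2) (c * a))
                (WghAt (toSite r) (m + 1) (-c) (c * ((m + 1 : ℕ) : ℝ) ^ 2) (c * a)) κ l u u'
      = ∑ κ : Fin 4, ∑' u : Site 4, colH (KInvStep (d := 3) (m + 1) 0) (m + 1) μ y κ u
          * ∑ l : Fin 4, ∑' u' : Site 4, colH (KInvStep (d := 3) (m + 1) 0) (m + 1) ν y' l u'
              * fineHessA (Ggh (m + 1) a) (SghAt (toSite r) (m + 1) (c * ((m + 1 : ℕ) : ℝ) ^ 2) (c * a))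
                  (WghAt (toSite r) (m + 1) (-c) (c * ((m + 1 : ℕ) : ℝ) ^ 2) (c * a)) κ l u u' :=
  ghost_pairing_dressed_eq_undressed m hr ha (toSite_inBlock hr) c μ y ν y'

end Road

end Summit.QuantumFields.BalabanUV.Beta.D1BFx.GhostWardTransversal

end
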